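import Literature.AlgebraicGeometry.ComplexMultiplication.TateModuleOfCMFreeRankOne
import Literature.AlgebraicGeometry.ComplexMultiplication.RationalCMStructureBaseChange
import Literature.NumberTheory.ComplexMultiplication.EllipticCurveEndomorphismsBaseChange
import Literature.AlgebraicGeometry.Motives.ComplexTorusEndomorphismAlgebraEquiv
import Literature.AlgebraicGeometry.Motives.AbelianVarietyTateModuleAlong
import Literature.AlgebraicGeometry.HodgeTheory.AbelianVarietyHodgeFullnessHolds
import Literature.Geometry.Kaehler.ComplexTorusRationalTateSequence
import HarnessLib

/-!
# The rational representation of `End⁰_K(B)` and its `ℓ`-adic comparison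
# (Lang, *Abelian Functions* VII §2 Thm. 2.1; Mumford §19 Thm. 3)

Layer `Literature/AlgebraicGeometry/ComplexMultiplication`, namespace `Literature.AlgebraicGeometry.ComplexMultiplication`.

For an abelian variety `B` over a field `K ⊆ ℂ` and a torus uniformisation `φ : ℝ^ι/ℤ^ι ⥲ B_ℂ(ℂ)` of its complexification
(`IsAnalytification`, additive), the **rational representation** is the injective `ℚ`-algebra homomorphism

  `ψ : End⁰_K(B) → End⁰(B_ℂ) ≅ End_ℚ(ℝ^ι/ℤ^ι) ⊆ M_ι(ℚ)`,

`x ↦ (endAlgebraEquivOfAnalytification (x_ℂ) : Matrix ι ι ℚ)` (the tree's `endAlgebraBaseChange ℂ B`, Lange's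
`End⁰(A) = End_ℚ(X)` `Motives.AbelianVariety.endAlgebraEquivOfAnalytification`, and `ComplexTorus.endAlgRat Φ ⊆ M_ι(ℚ)`):
`#ι = 2 dim B`.  Lang's Theorem 2.1 («the `ℓ`-adic representation is equivalent to the rational representation»)
says that for every prime `ℓ` there is a `ℚ_ℓ`-linear isomorphism `c : ℚ_ℓ^ι ⥲ V_ℓ(B) = ℚ_ℓ ⊗ T_ℓ(B(K̄))` with

  `c ∘ (ψ x)_ℓ = V_ℓ(x) ∘ c`  for all `x ∈ End⁰_K(B)`

(`V_ℓ(x)` = the tree's `Motives.AbelianVariety.rationalTateAction B ℓ x`, `(ψ x)_ℓ` = `Matrix.mulVecLin` of `ψ x` read in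
`ℚ_ℓ`, column vectors).  Main results:

* `exists_tateComparison_of_uniformisation` — the comparison `c` for a GIVEN uniformisation (`ψ` spelled out);
* `exists_ratRep_tateComparison_of_algebra` — packaged: `∃ ι ψ, ψ injective ∧ #ι = 2 dim B ∧ ∀ ℓ, ∃ c, ∀ x, c ∘ (ψ x)_ℓ =
  V_ℓ(x) ∘ c`, for any `[Algebra K ℂ]`;
* `exists_ratRep_tateComparison` — the same over a number field (an embedding into `ℂ` is chosen).

Proof (all on the tree's carriers, no new facts): `c` is `ℚ_ℓ ⊗ (T_ℓ(B) ≅ T_ℓ(B_ℂ(ℂ)) ≅ T_ℓ(ℝ^ι/ℤ^ι)) ≅ ℚ_ℓ^ι`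
(`tateModulePointsEquiv`, `TateModule.mapAddEquiv` of `φ`, `ComplexTorus.rationalTateModuleEquiv`); the integral square
`T_ℓ(F) ↔ T_ℓ(ρ_ℤ(F_ℂ))` is `F_ℂ(φ t) = φ(ρ_ℤ(F_ℂ) t)` (`endRingEquivOfAnalytification_symm_spec`) read componentwise, the
rational square is Lang's Thm. 2.1 in coordinates (`ComplexTorus.rationalTateModuleEquiv_map_mapMatrixHom`), and a general
`x = M⁻¹ (1 ⊗ F)` (`endAlgebra.exists_eq_algebraMap_mul_of`) follows by `ℚ`-linearity (`rationalTateAction_of_eq_algebraMap_mul_of`).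

USE (cell `hodgecm-mathlib`, D-0151, crux `HLiu418` = stmt-HodgeConjecture-24832, d6 card S2′ degree road (D2)): the consumer is
`Literature/RingTheory/SimpleModule/EndomorphismAlgebraFullRankOneProjector` (`exists_mem_isIdempotentElem_finrank_range_eq`),
which needs a faithful rational representation of the right size, (D2a), whose ranks can be computed `ℓ`-adically, (D2b).
-/

noncomputable section

open CategoryTheory AlgebraicGeometry Complex Cardinal Module Function
open scoped Matrix TensorProduct
open Literature.Geometry.Kaehler Literature.Geometry.Kaehler.ComplexTorus
open Literature.NumberTheory.Transcendental Literature.AlgebraicGeometry.HodgeTheory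
open Literature.AlgebraicGeometry.Motives Literature.AlgebraicGeometry.Motives.AbelianVariety
open Literature.NumberTheory.EllipticCurves (TateModule RationalTateModule)

namespace Literature.AlgebraicGeometry.ComplexMultiplication

/-! ### §1 Over `ℂ`: endomorphisms act on `T_ℓ` of the uniformising torus through their integer matrices -/

section Complex

variable (A : AbelianVariety ℂ) {ι : Type} [Fintype ι] [DecidableEq ι] {Φ : (ι → ℝ) ≃L[ℝ] (Fin A.dim → ℂ)}
  {φ : ComplexTorus Φ → ComplexPoints A.X}
  (hφ : IsAnalytification (Fin A.dim → ℂ) A.X A.dim φ) (hadd : ∀ x y, φ (x + y) = φ x * φ y)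
  (ℓ : ℕ) [Fact ℓ.Prime]

include hφ hadd in
/-- **`T_ℓ(u(ℂ)) ∘ T_ℓ(φ) = T_ℓ(φ) ∘ T_ℓ(ρ_ℤ(u))`**: for an additive isomorphism `e : ℝ^ι/ℤ^ι ≃ A(ℂ)` agreeing with the
uniformisation `φ` and `u ∈ End(A)`, the endomorphism acts on `T_ℓ` of the torus through its integer matrix
`ρ_ℤ(u) = (endRingEquivOfAnalytification φ)⁻¹ u` (`u(φ t) = φ(ρ_ℤ(u) t)`, componentwise).
[cite: Lang1982AbelianFunctions, Ch. VII §2, Thm. 2.1, p. 116] -/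
theorem tateModule_map_pointsAddMonoidHom_mapAddEquiv (e : ComplexTorus Φ ≃+ Additive (A.Points ℂ))
    (he : ∀ t, Additive.toMul (e t) = φ t) (u : End A) (a : TateModule (ComplexTorus Φ) ℓ) :
    TateModule.map ℓ (HodgeTheory.AbelianVariety.pointsAddMonoidHom (u : A ⟶ A)) (TateModule.mapAddEquiv ℓ e a) =
      TateModule.mapAddEquiv ℓ e (TateModule.map ℓ (mapMatrixHom Φ Φ
        (((endRingEquivOfAnalytification hφ hadd).symm u : endRingInt Φ) : Matrix ι ι ℤ)) a) :=
  have hpt : ∀ P, Additive.toMul (HodgeTheory.AbelianVariety.pointsAddMonoidHom (u : A ⟶ A) P) =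
      AlgPoints.map (u : A ⟶ A).hom.hom.hom (Additive.toMul P) := fun _ ↦ rfl
  TateModule.ext fun r ↦ by
    rw [TateModule.proj_map, TateModule.proj_mapAddEquiv, TateModule.proj_mapAddEquiv, TateModule.proj_map,
      mapMatrixHom_apply]
    apply Additive.toMul.injective
    rw [hpt, he, he]
    exact (endRingEquivOfAnalytification_symm_spec hφ hadd u _).symm

end Complex

/-! ### §2 Over `K ⊆ ℂ`: the comparison `c : ℚ_ℓ^ι ⥲ V_ℓ(B)` for a given uniformisation of `B_ℂ` -/

section OverK

variable {K : Type} [Field K] [Algebra K ℂ] (B : AbelianVariety K)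
  {ι : Type} [Fintype ι] [DecidableEq ι] {Φ : (ι → ℝ) ≃L[ℝ] (Fin (B.baseChange ℂ).dim → ℂ)}
  {φ : ComplexTorus Φ → ComplexPoints (B.baseChange ℂ).X}
  (hφ : IsAnalytification (Fin (B.baseChange ℂ).dim → ℂ) (B.baseChange ℂ).X (B.baseChange ℂ).dim φ)
  (hadd : ∀ x y, φ (x + y) = φ x * φ y) (ℓ : ℕ) [Fact ℓ.Prime]

omit [DecidableEq ι] in
/-- `#ι = 2 dim B` for a real frame `Φ : ℝ^ι ≃ ℂ^{dim B_ℂ}` of a uniformisation of `B_ℂ`. [folklore] -/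
private theorem card_eq_two_mul_dim (Φ : (ι → ℝ) ≃L[ℝ] (Fin (B.baseChange ℂ).dim → ℂ)) : Fintype.card ι = 2 * B.dim := by
  have h : Module.finrank ℝ (ι → ℝ) = Module.finrank ℝ (Fin (B.baseChange ℂ).dim → ℂ) :=
    LinearEquiv.finrank_eq Φ.toLinearEquiv
  rw [Module.finrank_fintype_fun_eq_card, finrank_real_of_complex, Module.finrank_fin_fun,
    AbelianVariety.dim_baseChange] at h
  exact h

include hφ hadd in
/-- **The integral square over `K`**: along `R := T_ℓ(φ)⁻¹… : T_ℓ(ℝ^ι/ℤ^ι) ≅ T_ℓ(B_ℂ(ℂ)) ≅ T_ℓ(B)` (`TateModule.mapAddEquiv`,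
`tateModulePointsEquiv`), `T_ℓ(F) ∘ R = R ∘ T_ℓ(ρ_ℤ(F_ℂ))` for every `F ∈ End_K(B)`.
[cite: Lang1982AbelianFunctions, Ch. VII §2, Thm. 2.1, p. 116] [cite: SerreTate1968, §1 p. 493] -/
theorem tateModuleMap_tateModulePointsEquiv_symm_mapAddEquiv [Algebra (AlgebraicClosure K) ℂ]
    [IsScalarTower K (AlgebraicClosure K) ℂ] (e : ComplexTorus Φ ≃+ Additive ((B.baseChange ℂ).Points ℂ))
    (he : ∀ t, Additive.toMul (e t) = φ t) (F : End B) (a : TateModule (ComplexTorus Φ) ℓ) :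
    tateModuleMap ℓ (F : B ⟶ B) ((B.tateModulePointsEquiv ℓ).symm (TateModule.mapAddEquiv ℓ e a)) =
      (B.tateModulePointsEquiv ℓ).symm (TateModule.mapAddEquiv ℓ e (TateModule.map ℓ (mapMatrixHom Φ Φ
        (((endRingEquivOfAnalytification hφ hadd).symm (Hom.baseChange ℂ F : End (B.baseChange ℂ)) : endRingInt Φ) :
          Matrix ι ι ℤ)) a)) := by
  apply (B.tateModulePointsEquiv ℓ).injective
  rw [tateModulePointsEquiv_tateModuleMap, LinearEquiv.apply_symm_apply, LinearEquiv.apply_symm_apply]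
  exact tateModule_map_pointsAddMonoidHom_mapAddEquiv (B.baseChange ℂ) hφ hadd ℓ e he (Hom.baseChange ℂ F) a

omit [Fintype ι] [DecidableEq ι] in
/-- `ℚ_ℓ ⊗ R` for a `ℤ_ℓ`-isomorphism `R : T_ℓ(ℝ^ι/ℤ^ι) ≅ T_ℓ(B)`, on the tree's `RationalTateModule` synonyms, with its value on
pure tensors. [folklore] -/
private theorem exists_rationalTateModule_equiv (R : TateModule (ComplexTorus Φ) ℓ ≃ₗ[ℤ_[ℓ]] B.tateModule ℓ) :
    ∃ cK : RationalTateModule (ComplexTorus Φ) ℓ ≃ₗ[ℚ_[ℓ]] B.rationalTateModule ℓ,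
      ∀ (q : ℚ_[ℓ]) (a : TateModule (ComplexTorus Φ) ℓ),
        cK ((q ⊗ₜ[ℤ_[ℓ]] a : ℚ_[ℓ] ⊗[ℤ_[ℓ]] TateModule (ComplexTorus Φ) ℓ) : RationalTateModule (ComplexTorus Φ) ℓ) =
          ((q ⊗ₜ[ℤ_[ℓ]] R a : ℚ_[ℓ] ⊗[ℤ_[ℓ]] B.tateModule ℓ) : B.rationalTateModule ℓ) :=
  ⟨(LinearEquiv.baseChange ℤ_[ℓ] ℚ_[ℓ] _ _ R :
      RationalTateModule (ComplexTorus Φ) ℓ ≃ₗ[ℚ_[ℓ]] B.rationalTateModule ℓ), fun _ _ ↦ rfl⟩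

include hφ hadd in
/-- **Lang VII §2 Thm. 2.1 for `End⁰_K(B)` — the `ℓ`-adic representation is equivalent to the rational representation**:
for a uniformisation `φ : ℝ^ι/ℤ^ι ⥲ B_ℂ(ℂ)` there is `c : ℚ_ℓ^ι ≃ V_ℓ(B)` with `c ∘ (ψ x)_ℓ = V_ℓ(x) ∘ c` for all
`x ∈ End⁰_K(B)`, `ψ x = endAlgebraEquivOfAnalytification (x_ℂ)` the rational representation (column vectors, `Matrix.mulVecLin`).
[cite: Lang1982AbelianFunctions, Ch. VII §2, Thm. 2.1, p. 116] [cite: MumfordAV1970, §19 Thm. 3 (p. 176)] -/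
theorem exists_tateComparison_of_uniformisation :
    ∃ c : (ι → ℚ_[ℓ]) ≃ₗ[ℚ_[ℓ]] B.rationalTateModule ℓ, ∀ x : B.endAlgebra,
      (c : (ι → ℚ_[ℓ]) →ₗ[ℚ_[ℓ]] B.rationalTateModule ℓ) ∘ₗ
          Matrix.mulVecLin ((((endAlgebraEquivOfAnalytification hφ hadd (endAlgebraBaseChange ℂ B x) : endAlgRat Φ) :
            Matrix ι ι ℚ)).map (algebraMap ℚ ℚ_[ℓ])) =
        (rationalTateAction B ℓ x : Module.End ℚ_[ℓ] (B.rationalTateModule ℓ)) ∘ₗ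
          (c : (ι → ℚ_[ℓ]) →ₗ[ℚ_[ℓ]] B.rationalTateModule ℓ) := by
  classical
  letI : Algebra (AlgebraicClosure K) ℂ := (algebraicClosureAlgHom K).toRingHom.toAlgebra
  haveI : IsScalarTower K (AlgebraicClosure K) ℂ := IsScalarTower.of_algebraMap_eq fun x ↦ by
    rw [RingHom.algebraMap_toAlgebra]; exact ((algebraicClosureAlgHom K).commutes x).symm
  -- the uniformisation as an additive isomorphism `e : ℝ^ι/ℤ^ι ≃ B_ℂ(ℂ)`
  have hbij : Bijective φ := hφ.isHomeomorph.bijective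
  let e : ComplexTorus Φ ≃+ Additive ((B.baseChange ℂ).Points ℂ) :=
    AddEquiv.mk' ((Equiv.ofBijective φ hbij).trans Additive.ofMul) fun x y ↦ by
      change Additive.ofMul (φ (x + y)) = Additive.ofMul (φ x) + Additive.ofMul (φ y)
      rw [hadd, ofMul_mul]
  have he : ∀ t, Additive.toMul (e t) = φ t := fun _ ↦ rfl
  -- `c_K := ℚ_ℓ ⊗ (T_ℓ(φ) then T_ℓ(B_ℂ(ℂ)) ≅ T_ℓ(B))`, `c := c_K ∘ (ℚ_ℓ^ι ≅ V_ℓ(ℝ^ι/ℤ^ι))`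
  obtain ⟨cK, hcK⟩ :=
    exists_rationalTateModule_equiv B ℓ ((TateModule.mapAddEquiv ℓ e).trans (B.tateModulePointsEquiv ℓ).symm)
  refine ⟨(rationalTateModuleEquiv Φ ℓ).symm.trans cK, fun x ↦ ?_⟩
  obtain ⟨M, F, hM, hx⟩ := AbelianVariety.endAlgebra.exists_eq_algebraMap_mul_of x
  set N : Matrix ι ι ℤ :=
    (((endRingEquivOfAnalytification hφ hadd).symm (Hom.baseChange ℂ F : End (B.baseChange ℂ)) : endRingInt Φ) :
      Matrix ι ι ℤ) with hN
  -- `ψ x = M⁻¹ ρ_ℤ(F_ℂ)` and `V_ℓ(x) = M⁻¹ V_ℓ(F)`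
  have hψ : (((endAlgebraEquivOfAnalytification hφ hadd (endAlgebraBaseChange ℂ B x) : endAlgRat Φ) :
      Matrix ι ι ℚ)).map (algebraMap ℚ ℚ_[ℓ]) = ((M : ℚ_[ℓ])⁻¹) • N.map (Int.castRingHom ℚ_[ℓ]) := by
    rw [hx, map_mul, map_mul, AlgHom.commutes, AlgEquiv.commutes, endAlgebraBaseChange_of,
      endAlgebraEquivOfAnalytification_of, Subalgebra.coe_mul, Subalgebra.coe_algebraMap, Algebra.algebraMap_eq_smul_one,
      smul_one_mul, endToEndAlgRat_apply, coe_endRingIntToEndAlgRat, ← hN]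
    ext i j
    simp only [Matrix.map_apply, Matrix.smul_apply, smul_eq_mul, map_mul, map_inv₀, map_natCast, map_intCast,
      Int.coe_castRingHom]
  have hV : rationalTateAction B ℓ x =
      ((M : ℚ_[ℓ])⁻¹) • (rationalTateModuleMap ℓ (F : B ⟶ B) : Module.End ℚ_[ℓ] (B.rationalTateModule ℓ)) :=
    rationalTateAction_of_eq_algebraMap_mul_of B ℓ hx
  rw [hψ, hV]
  refine LinearMap.ext fun v ↦ ?_
  rw [LinearMap.comp_apply, LinearMap.comp_apply, Matrix.mulVecLin_apply, Matrix.smul_mulVec,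
    LinearEquiv.coe_coe, map_smul, LinearMap.smul_apply]
  congr 1
  -- the rational square `V_ℓ(F) ∘ c_K = c_K ∘ V_ℓ(ρ_ℤ(F_ℂ))` (checked on pure tensors, from the integral square)
  have hsq' : rationalTateModuleMap ℓ (F : B ⟶ B) ∘ₗ cK.toLinearMap =
      cK.toLinearMap ∘ₗ RationalTateModule.map ℓ (mapMatrixHom Φ Φ N) := by
    refine TensorProduct.AlgebraTensorModule.ext fun q a ↦ ?_
    change rationalTateModuleMap ℓ (F : B ⟶ B)
        (cK ((q ⊗ₜ[ℤ_[ℓ]] a : ℚ_[ℓ] ⊗[ℤ_[ℓ]] TateModule (ComplexTorus Φ) ℓ) : RationalTateModule (ComplexTorus Φ) ℓ)) =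
      cK (RationalTateModule.map ℓ (mapMatrixHom Φ Φ N)
        ((q ⊗ₜ[ℤ_[ℓ]] a : ℚ_[ℓ] ⊗[ℤ_[ℓ]] TateModule (ComplexTorus Φ) ℓ) : RationalTateModule (ComplexTorus Φ) ℓ))
    rw [Literature.NumberTheory.EllipticCurves.RationalTateModule.map_tmul, hcK, hcK, rationalTateModuleMap_tmul,
      LinearEquiv.trans_apply, LinearEquiv.trans_apply,
      tateModuleMap_tateModulePointsEquiv_symm_mapAddEquiv B hφ hadd ℓ e he F a]
  have hsq := LinearMap.congr_fun hsq' ((rationalTateModuleEquiv Φ ℓ).symm v)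
  rw [LinearMap.comp_apply, LinearMap.comp_apply, LinearEquiv.coe_coe] at hsq
  rw [LinearEquiv.trans_apply, LinearEquiv.trans_apply]
  change cK ((rationalTateModuleEquiv Φ ℓ).symm (N.map (Int.castRingHom ℚ_[ℓ]) *ᵥ v)) =
    rationalTateModuleMap ℓ (F : B ⟶ B) (cK ((rationalTateModuleEquiv Φ ℓ).symm v))
  have hv : (rationalTateModuleEquiv Φ ℓ).symm (N.map (Int.castRingHom ℚ_[ℓ]) *ᵥ v) =
      RationalTateModule.map ℓ (mapMatrixHom Φ Φ N) ((rationalTateModuleEquiv Φ ℓ).symm v) := by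
    apply (rationalTateModuleEquiv Φ ℓ).injective
    rw [LinearEquiv.apply_symm_apply, rationalTateModuleEquiv_map_mapMatrixHom, LinearEquiv.apply_symm_apply]
  rw [hv]
  exact hsq.symm

/-- **(D2) packaged over any `K ⊆ ℂ`: a faithful rational representation of `End⁰_K(B)` of size `2 dim B` together with its
`ℓ`-adic comparisons** — `∃ ι ψ, ψ injective ∧ #ι = 2 dim B ∧ ∀ ℓ, ∃ c : ℚ_ℓ^ι ≃ V_ℓ(B), ∀ x, c ∘ (ψ x)_ℓ = V_ℓ(x) ∘ c`
(uniformise `B_ℂ` by `complexAbelianVariety_torusUniformised_holds`; `ψ = ρ_r ∘ (·)_ℂ` is injective by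
`endAlgebraBaseChange_injective`). [cite: Lang1982AbelianFunctions, Ch. VII §2, Thm. 2.1, p. 116]
[cite: MumfordAV1970, §19 Thm. 3 (p. 176)] [cite: SerreTate1968, §1 p. 493] -/
theorem exists_ratRep_tateComparison_of_algebra :
    ∃ (ι : Type) (_ : Fintype ι) (_ : DecidableEq ι) (ψ : B.endAlgebra →ₐ[ℚ] Matrix ι ι ℚ),
      Injective ψ ∧ Fintype.card ι = 2 * B.dim ∧
        ∀ (ℓ : ℕ) [Fact ℓ.Prime], ∃ c : (ι → ℚ_[ℓ]) ≃ₗ[ℚ_[ℓ]] B.rationalTateModule ℓ, ∀ x : B.endAlgebra,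
          (c : (ι → ℚ_[ℓ]) →ₗ[ℚ_[ℓ]] B.rationalTateModule ℓ) ∘ₗ Matrix.mulVecLin ((ψ x).map (algebraMap ℚ ℚ_[ℓ])) =
            (rationalTateAction B ℓ x : Module.End ℚ_[ℓ] (B.rationalTateModule ℓ)) ∘ₗ
              (c : (ι → ℚ_[ℓ]) →ₗ[ℚ_[ℓ]] B.rationalTateModule ℓ) := by
  obtain ⟨ι, _, _, Φ, φ, hφ, hadd⟩ := complexAbelianVariety_torusUniformised_holds (B.baseChange ℂ)
  refine ⟨ι, inferInstance, inferInstance,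
    ((endAlgRat Φ).val.comp (endAlgebraEquivOfAnalytification hφ hadd).toAlgHom).comp (endAlgebraBaseChange ℂ B),
    (Subtype.val_injective.comp (endAlgebraEquivOfAnalytification hφ hadd).injective).comp
      (Literature.NumberTheory.ComplexMultiplication.endAlgebraBaseChange_injective B),
    card_eq_two_mul_dim B Φ, fun ℓ _ ↦ exists_tateComparison_of_uniformisation B hφ hadd ℓ⟩

end OverK

/-! ### §3 Over a number field -/

/-- **(D2) over a number field `E`: `End⁰_E(B)` has a faithful rational representation `ψ : End⁰_E(B) → M_{2 dim B}(ℚ)` whose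
`ℓ`-adic extension is, for every prime `ℓ`, conjugate to the `ℓ`-adic representation on `V_ℓ(B)`** (choose `E ⊆ ℂ` and apply
`exists_ratRep_tateComparison_of_algebra`).  This is the Betti-side input of the S2′ degree road: the ranks of `ψ(x)`, `x ∈ End⁰_E(B)`,
are the `ℚ_ℓ`-ranks of `V_ℓ(x)`. [cite: Lang1982AbelianFunctions, Ch. VII §2, Thm. 2.1, p. 116] [cite: MumfordAV1970, §19 Thm. 3 (p. 176)]
[cite: SerreTate1968, §1 p. 493] -/
theorem exists_ratRep_tateComparison {E : Type} [Field E] [NumberField E] (B : AbelianVariety E) :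
    ∃ (ι : Type) (_ : Fintype ι) (_ : DecidableEq ι) (ψ : B.endAlgebra →ₐ[ℚ] Matrix ι ι ℚ),
      Injective ψ ∧ Fintype.card ι = 2 * B.dim ∧
        ∀ (ℓ : ℕ) [Fact ℓ.Prime], ∃ c : (ι → ℚ_[ℓ]) ≃ₗ[ℚ_[ℓ]] B.rationalTateModule ℓ, ∀ x : B.endAlgebra,
          (c : (ι → ℚ_[ℓ]) →ₗ[ℚ_[ℓ]] B.rationalTateModule ℓ) ∘ₗ Matrix.mulVecLin ((ψ x).map (algebraMap ℚ ℚ_[ℓ])) =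
            (rationalTateAction B ℓ x : Module.End ℚ_[ℓ] (B.rationalTateModule ℓ)) ∘ₗ
              (c : (ι → ℚ_[ℓ]) →ₗ[ℚ_[ℓ]] B.rationalTateModule ℓ) :=
  letI : Algebra E ℂ := (Classical.choice (inferInstance : Nonempty (E →+* ℂ))).toAlgebra
  exists_ratRep_tateComparison_of_algebra B

end Literature.AlgebraicGeometry.ComplexMultiplication

end
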